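import Summits.HodgeConjecture.CorCM.MumfordTateRankSevenSimpleConverse
import Literature.AlgebraicGeometry.Milne1999.CMTypeSubquotients
import HarnessLib

/-!
# The rung `dim MT(H¹(X)) = 7`, CONVERSE of the split shape: `X ∼ B₁^{a+1} × B₂^{b+1}` with `B₁ ≁ B₂` non-CM elliptic
# curves / quaternion surfaces has `dim MT(H¹X) = 7`, no factor of type IV, `𝔷 = 0`

COR-CM (cell `pub-hodgecm2`, seat `b27` gen 42, count-neutral Mumford–Tate-rank ladder; theorems only, no definition, no named
fact; UNCONDITIONAL — nothing here uses or asserts HC_CM).  gen 39 (`CorCM/MumfordTateRankSevenSemisimple`,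
`…SplitIsogeny`) proved: `𝔷 = 0`, `dim MT(H¹X) = 7` and `Lie Hg(H¹X)` NOT `ℚ`-simple ⟹ `X ∼ B₁^{a+1} × B₂^{b+1}` with `B₁ ≁ B₂`
SIMPLE, NOT of CM type, `0 < dim Bᵢ ≤ 2`, `dim_ℚ End⁰Bᵢ = (dim Bᵢ)²`, `Z(End⁰Bᵢ) = ℚ` (non-isogenous non-CM elliptic curves /
quaternion surfaces).  This file proves the CONVERSE — the Lie-algebra form of «`Hg(B₁ × B₂) = Hg(B₁) × Hg(B₂) = SL₂ × SL₂`
for non-isogenous `B₁`, `B₂` of this kind» (Moonen–Zarhin 1999 §3 (3.1), Imai for curves):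

* **`mtRank_hodge_one_eq_seven_of_isIsogenous_powSucc_prod_powSucc`** — such an `X` has `dim MT(H¹X) = 7`, NO factor of type
  IV, `𝔷 = Lie Hg ∩ End_Hdg = 0`, and is not of CM type.

PROOF (Goursat by counting).  `Z(End⁰Bᵢ) = ℚ` ⟹ no factor of type IV (`hasNoTypeIVFactor_of_center_le_bot`, products,
isogeny), so `𝔷 = 0` and `t := dim MT(H¹X) ∉ {5, 6}` (`mtRank_hodge_one_ne_of_hasNoTypeIVFactor`); `X` is not CM (its factor
`B₁` is not), so `t ≥ 4`; `dim Lie Hg(H¹X) ≤ dim Lie Hg(H¹B₁) + dim Lie Hg(H¹(B₂^{b+1})) ≤ 3 + 3` (`Hg(X₁ × X₂) ⊆ Hg(X₁) × Hg(X₂)`,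
`Hg(Bⁿ) ⊆ Hg(B)`, and `dim Lie Hg ≤ 3` for non-CM curves / quaternion surfaces), so `t ≤ 7`.  Were `t = 4`, the rung-`4`
structure theorem (`exists_isIsogenous_power_of_not_isOfCMType`) would make `X ∼ B^{m+1}` ISOTYPIC, and the simple
`B₁ ≼ X`, `B₂ ≼ X` would both be isogenous to `B` (`exists_isIsogenous_of_isSimple_of_avDominatedBy_biproduct`) — but
`B₁ ≁ B₂`.  Hence `t = 7`.  (That `Lie Hg(H¹X)` is then NOT `ℚ`-simple — every position of the simple branch is isotypic —
is drawn in the sequel `CorCM/MumfordTateRankSevenSplitIff`, which needs the type-III isogeny theorem.)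

## References

* [MoonenZarhin1999LowDim] B. Moonen, Yu. Zarhin, *Hodge classes on abelian varieties of low dimension*, Math. Ann.
  315 (1999), §1, §2 (2.1)–(2.2) and §3 (3.1), Cor. (3.7).
* [MumfordAV1970] D. Mumford, *Abelian Varieties* (1970), §19 Thm. 1, Cor. 1–2 (pp. 173–174).
* [Deligne1982HodgeCycles] P. Deligne, *Hodge cycles on abelian varieties*, LNM 900 (1982), I §3.1 and Prop. 3.4.
-/

noncomputable section

open scoped TensorProduct
open CategoryTheory CategoryTheory.Limits Module

namespace Summit.HodgeConjecture.CorCM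

open Literature.AlgebraicGeometry.Motives
open Literature.AlgebraicGeometry.Motives.AbelianVariety
open Literature.AlgebraicGeometry.Motives.HodgeStructure
open Literature.AlgebraicGeometry.HodgeTheory
open Literature.AlgebraicGeometry.Milne1999 (IsOfCMType isOfCMType_powSucc_iff dim_powSucc_pos)
open Literature.AlgebraicGeometry.Pohlmann1968 (isIsogenous_powSucc_biproduct)
open Summit.HodgeConjecture.CorCM.Domination
open Summit.HodgeConjecture.CorCM.SliceExhaustion (avDominatedBy_prod_left)

variable [HodgeTensorFacts.{0, 0}] {X : AbelianVariety ℂ} {n : ℕ}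

omit [HodgeTensorFacts.{0, 0}] in
/-- **No factor of type IV for `X ∼ B₁^{a+1} × B₂^{b+1}` when `Z(End⁰B₁) = Z(End⁰B₂) = ℚ`** (centres `ℚ` are totally real;
products and isogeny invariance). [cite: MoonenZarhin1999LowDim, §1] [cite: MumfordAV1970, §19 Cor. 2 (p. 174)] -/
theorem hasNoTypeIVFactor_of_isIsogenous_powSucc_prod_powSucc_of_finrank_center_eq_one {B₁ B₂ : AbelianVariety ℂ}
    (hZ₁ : Module.finrank ℚ (Subalgebra.center ℚ B₁.endAlgebra) = 1)
    (hZ₂ : Module.finrank ℚ (Subalgebra.center ℚ B₂.endAlgebra) = 1) {a b : ℕ}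
    (hXB : IsIsogenous X ((B₁.powSucc a).prod (B₂.powSucc b))) : HasNoTypeIVFactor X :=
  ((hasNoTypeIVFactor_of_center_le_bot (le_of_eq (Subalgebra.eq_bot_of_finrank_one hZ₁))).powSucc_prod_powSucc
    (hasNoTypeIVFactor_of_center_le_bot (le_of_eq (Subalgebra.eq_bot_of_finrank_one hZ₂))) a b).of_isIsogenous hXB

/-- **`dim Lie Hg(H¹X) ≤ 6` for `X ∼ B₁^{a+1} × B₂^{b+1}` with `Bᵢ` simple, not CM, `0 < dim Bᵢ ≤ 2`, `dim End⁰Bᵢ = (dim Bᵢ)²`**: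
`Hg(X₁ × X₂) ⊆ Hg(X₁) × Hg(X₂)`, `Hg(Bⁿ) ⊆ Hg(B)` and `dim Lie Hg(H¹Bᵢ) ≤ 3` (non-CM elliptic curves / quaternion surfaces).
[cite: MoonenZarhin1999LowDim, §1, §2 (2.1)–(2.2) and §3 first paragraph] [cite: Deligne1982HodgeCycles, I Prop. 3.4] -/
theorem finrank_hodgeLie_hodge_one_le_six_of_isIsogenous_powSucc_prod_powSucc (hX : IsSmoothProjective n X.X)
    {B₁ B₂ : AbelianVariety ℂ} (hB₁s : B₁.IsSimple) (hB₂s : B₂.IsSimple) (hB₁0 : 0 < B₁.dim) (hB₁2 : B₁.dim ≤ 2)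
    (hB₂0 : 0 < B₂.dim) (hB₂2 : B₂.dim ≤ 2) (hB₁cm : ¬ IsOfCMType B₁) (hB₂cm : ¬ IsOfCMType B₂)
    (hE₁ : Module.finrank ℚ B₁.endAlgebra = B₁.dim ^ 2) (hE₂ : Module.finrank ℚ B₂.endAlgebra = B₂.dim ^ 2) {a b : ℕ}
    (hXB : IsIsogenous X ((B₁.powSucc a).prod (B₂.powSucc b))) :
    haveI := BettiUniverse.finite hX 1
    Module.finrank ℚ (BettiUniverse.hodge exists_isReal_hodgeModel_holds hX 1).hodgeLie ≤ 6 := by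
  classical
  haveI := BettiUniverse.finite hX 1
  have hsp : ∀ A : AbelianVariety ℂ, IsSmoothProjective A.dim A.X := fun A => AbelianVariety.isSmoothProjective_holds
  -- `dim 𝔥(X) ≤ dim 𝔥(B₁) + dim 𝔥(B₂^{b+1})`
  have h1 := finrank_hodgeLie_hodge_one_le_add_of_isIsogenous_powSucc_prod hX hXB
  -- `dim 𝔥(B₁) ≤ 3`, `dim 𝔥(B₂) ≤ 3`
  obtain ⟨-, h3₁⟩ := not_le_endAlg_and_finrank_hodgeLie_le_three_of_factor hB₁s hB₁0 hB₁cm hE₁ hB₁2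
  obtain ⟨-, h3₂⟩ := not_le_endAlg_and_finrank_hodgeLie_le_three_of_factor hB₂s hB₂0 hB₂cm hE₂ hB₂2
  -- `dim 𝔥(B₂^{b+1}) = dim 𝔥(⨁ B₂) ≤ dim 𝔥(B₂)`
  have h2 := AbelianVariety.finrank_hodgeLie_hodge_one_eq_of_isIsogenous (hsp (B₂.powSucc b))
    (hsp (⨁ fun _ : Fin (b + 1) => B₂)) (isIsogenous_powSucc_biproduct B₂ b)
  have h3 := AbelianVariety.finrank_hodgeLie_hodge_one_biproduct_const_le (hsp B₂) (hsp (⨁ fun _ : Fin (b + 1) => B₂))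
    (a := b)
  omega

/-- **CONVERSE of the split shape of the rung `dim MT(H¹X) = 7`.**  Let `B₁`, `B₂` be simple complex abelian varieties, not of
CM type, with `0 < dim Bᵢ ≤ 2`, `dim_ℚ End⁰Bᵢ = (dim Bᵢ)²` and `Z(End⁰Bᵢ) = ℚ` (non-CM elliptic curves / quaternion surfaces),
`B₁ ≁ B₂`, and let `X ∼ B₁^{a+1} × B₂^{b+1}`.  Then **`dim MT(H¹X) = 7`**, `X` has NO factor of type IV, `𝔷 = Lie Hg ∩ End_Hdg =
0`, and `X` is not of CM type.  (Goursat by counting: `4 ≤ t ≤ 7`, `t ∉ {5,6}` without type-IV factors, and `t = 4` would make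
`X` isotypic with `B₁ ∼ B ∼ B₂`.)  Together with gen 39's `isSimple_or_exists_isIsogenous_powSucc_prod_powSucc_of_center_eq_bot_…`
this makes the split rung an iff at the level of isogeny shapes. [cite: MoonenZarhin1999LowDim, §1, §2 (2.1)–(2.2), §3 (3.1) and Cor. (3.7)]
[cite: MumfordAV1970, §19 Thm. 1, Cor. 1–2 (pp. 173–174)] [cite: Deligne1982HodgeCycles, I Prop. 3.4] -/
theorem mtRank_hodge_one_eq_seven_of_isIsogenous_powSucc_prod_powSucc (hX : IsSmoothProjective n X.X)
    {B₁ B₂ : AbelianVariety ℂ} (hB₁s : B₁.IsSimple) (hB₂s : B₂.IsSimple) (hB₁0 : 0 < B₁.dim) (hB₁2 : B₁.dim ≤ 2)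
    (hB₂0 : 0 < B₂.dim) (hB₂2 : B₂.dim ≤ 2) (hB₁cm : ¬ IsOfCMType B₁) (hB₂cm : ¬ IsOfCMType B₂)
    (hE₁ : Module.finrank ℚ B₁.endAlgebra = B₁.dim ^ 2) (hZ₁ : Module.finrank ℚ (Subalgebra.center ℚ B₁.endAlgebra) = 1)
    (hE₂ : Module.finrank ℚ B₂.endAlgebra = B₂.dim ^ 2) (hZ₂ : Module.finrank ℚ (Subalgebra.center ℚ B₂.endAlgebra) = 1)
    (h12 : ¬ IsIsogenous B₁ B₂) {a b : ℕ} (hXB : IsIsogenous X ((B₁.powSucc a).prod (B₂.powSucc b))) :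
    haveI := BettiUniverse.finite hX 1
    (BettiUniverse.hodge exists_isReal_hodgeModel_holds hX 1).mtRank = 7 ∧ HasNoTypeIVFactor X ∧
      (BettiUniverse.hodge exists_isReal_hodgeModel_holds hX 1).hodgeLie ⊓
        Subalgebra.toSubmodule (BettiUniverse.hodge exists_isReal_hodgeModel_holds hX 1).endAlg = ⊥ ∧
      ¬ IsOfCMType X := by
  classical
  haveI := BettiUniverse.finite hX 1
  have hA4 : HasNoTypeIVFactor X :=
    hasNoTypeIVFactor_of_isIsogenous_powSucc_prod_powSucc_of_finrank_center_eq_one hZ₁ hZ₂ hXB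
  have hz := hodgeLie_hodge_one_inf_endAlg_eq_bot_of_hasNoTypeIVFactor hX hA4
  -- `X` is not of CM type: its factor `B₁` is not
  have hcm : ¬ IsOfCMType X := fun h =>
    hB₁cm ((isOfCMType_powSucc_iff a).1 (h.of_isIsogenous_prod_left hXB))
  obtain ⟨g, hg⟩ := hXB
  have h0 : 0 < X.dim := by
    rw [dim_eq_of_isIsogeny hg, dim_prod]
    have := dim_powSucc_pos hB₁0 a
    omega
  -- `4 ≤ t ≤ 7`, `t ∉ {5, 6}`
  have h4 := four_le_mtRank_hodge_one_of_not_isOfCMType hX hcm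
  have h6 := finrank_hodgeLie_hodge_one_le_six_of_isIsogenous_powSucc_prod_powSucc hX hB₁s hB₂s hB₁0 hB₁2 hB₂0 hB₂2
    hB₁cm hB₂cm hE₁ hE₂ ⟨g, hg⟩
  have ht := mtRank_hodge_one_eq_finrank_hodgeLie_add_one hX h0
  obtain ⟨-, -, h5, h6', -⟩ := mtRank_hodge_one_ne_of_hasNoTypeIVFactor hX h0 hA4
  -- `t ≠ 4`: otherwise `X` is isotypic and `B₁ ∼ B ∼ B₂`
  have hne4 : (BettiUniverse.hodge exists_isReal_hodgeModel_holds hX 1).mtRank ≠ 4 := by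
    intro ht4
    obtain ⟨B, m, hBs, -, -, ⟨f, hf⟩, -⟩ := exists_isIsogenous_power_of_not_isOfCMType hX h0 hcm ht4.le
    have hdom₁ : AVDominatedBy B₁ (⨁ fun _ : Fin (m + 1) => B) :=
      ((((avDominatedBy_powSucc_of_le B₁ (Nat.zero_le a)).trans (avDominatedBy_prod_left _ _)).trans_isIsogeny_inv
        hg).trans_isIsogeny_hom hf)
    have hdom₂ : AVDominatedBy B₂ (⨁ fun _ : Fin (m + 1) => B) :=
      ((((avDominatedBy_powSucc_of_le B₂ (Nat.zero_le b)).trans (avDominatedBy_prod_right _ _)).trans_isIsogeny_inv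
        hg).trans_isIsogeny_hom hf)
    obtain ⟨-, h₁⟩ := exists_isIsogenous_of_isSimple_of_avDominatedBy_biproduct (fun _ => hBs) hB₁s hB₁0 hdom₁
    obtain ⟨-, h₂⟩ := exists_isIsogenous_of_isSimple_of_avDominatedBy_biproduct (fun _ => hBs) hB₂s hB₂0 hdom₂
    exact h12 (h₁.trans h₂.symm')
  refine ⟨by omega, hA4, hz, hcm⟩

end Summit.HodgeConjecture.CorCM

end
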